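import Summits.QuantumFields.BalabanUV.Beta.GAN24.BiStencilZeroMode
import Summits.QuantumFields.BalabanUV.Beta.GAN24.TaylorBlockSum

/-!
# `BalabanUV.Beta.GAN24.ZeroModeCoarseCount` — binder row G-an2-4 / (CONV-C), W-slot, road «W3» (F2): THE CELL COUNT OF THE ZERO-MODE
# CHARGE FOR A UNIT-COVARIANT FAMILY — `zmode N X = N^{d+1} · zmode 1 X`

NOT IN PRINT; OUR BOOKKEEPING (G-an2-4 formalisation swarm, leaf seat `b2b-balaban-gan24-formalise-leaf-18`, gen 16; module name PROVISIONAL —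
the row owner gan24-p1 ∕ the `zmode` author leaf-02 may rename or re-home it).  HONEST FRAMING (cell contract, verbatim): «discharging `BetaPertH`
makes Bałaban's UV stability UNCONDITIONAL — a real constructive-QFT result; it is NOT the continuum limit and NOT the Clay problem.»  HONEST
DEPENDENCY (verbatim): «continuum YM on T⁴ ⇐ BetaPertH ∧ nine spine estimates (0/9 proved); BetaPertH ⇐ (D1) ∧ (D4) ∧ CAP+tail; G-an2-4 gates asym,
D1 and NE2/3/4.»  [folklore] lattice-sum bookkeeping over leaf-02's `BiStencilZeroMode` (`zmode`, `zmode_one`, `inner_periodic`) and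
`TaylorBlockSum.card_box` BY NAME; 0 `def`, 0 `def … : Prop`, 0 cite, 0 sorry; asserts NO shape of Bałaban's tables; discharges NOTHING of
(hW, hWall); NOT «W-slot closed», NEVER «G-an2-4 closed»; NOT BetaPertH, NOT continuum, NOT Clay.

WHY (XREAD C-gan24leaf18-g16-3, INFO I1, journal l.8814).  (Z0) in the tree (`LinT2ZeroMode.zmode_one_linT2_kronecker'`, leaf-02 p212473) reads the
charge of the TRANSPORTED table at period `1` of the coarse lattice — `zmode 1 (linT2 K N T)` — against `zmode N T` of the input; the W3 tower
(`WSlotT2OfPieces`, ROWS W3-F2b ∕ W3-F4d) reads EVERY level at period `Lc` of its own lattice.  The transported family is jointly covariant under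
ALL coarse unit translations (`LinT2ZeroMode.linT2_translate`), and for such a UNIT-COVARIANT family the inner triple sum does not depend on the
first bond at all, so the period-`N` charge is the cell count `N^{d+1}` times the period-`1` charge.  This file is that one lemma (generic `d`,
any `N ≥ 1`, any unit-covariant bi-stencil family), the «density factor `Lc^{d+1}`» of the zero-mode eigenvalue `λ = +cE₂·Lc^{−(d+5)}`.

CONTENT.  `inner_const_of_unit_cov` (the inner triple sum at any first bond equals the one at `0`), **`zmode_eq_pow_mul_zmode_one`**
(`zmode N X κ κ′ a b = N^{d+1} · zmode 1 X κ κ′ a b`).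
-/

noncomputable section

namespace Summit.QuantumFields.BalabanUV.Beta.GAN24.ZeroModeCoarseCount

open Finset
open scoped BigOperators
open Literature.MathematicalPhysics.QuantumFieldTheory
open Literature.MathematicalPhysics.QuantumFieldTheory.Balaban1983to89
open Literature.MathematicalPhysics.QuantumFieldTheory.Balaban1983to89.Beta
open ExpKernelCalculus (MKer shiftK)
open OneStepResolventKernel (Fib)
open AffineAveraging (box toSite)
open Summit.QuantumFields.BalabanUV.Beta.GAN24.BiStencilZeroMode (Tab zmode zmode_one inner_periodic)
open Summit.QuantumFields.BalabanUV.Beta.GAN24.TaylorBlockSum (card_box)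

variable {d : ℕ}

/-- [folklore] For a family covariant under ALL joint unit translations of its four positions, the inner triple sum
`u ↦ Σ'_{u′} Σ'_x Σ'_z X κ u κ′ u′ x z a b` is CONSTANT in the first bond (leaf-02's `inner_periodic` at period `1`). -/
theorem inner_const_of_unit_cov {X : Tab d}
    (h1 : ∀ κ u κ' u' t, X κ (u + t) κ' (u' + t) = shiftK (-t) (X κ u κ' u')) (κ κ' : Fin (d + 1)) (a b : Fib d)
    (u : Fin (d + 1) → ℤ) :
    (∑' u', ∑' x, ∑' z, X κ u κ' u' x z a b) = ∑' u', ∑' x, ∑' z, X κ 0 κ' u' x z a b := by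
  have hT : ∀ κ u κ' u' t, X κ (u + ((1 : ℕ) : ℤ) • t) κ' (u' + ((1 : ℕ) : ℤ) • t) = shiftK (-(((1 : ℕ) : ℤ) • t)) (X κ u κ' u') := by
    intro κ u κ' u' t
    simpa only [Nat.cast_one, one_smul] using h1 κ u κ' u' t
  have h := inner_periodic (N := 1) (T := X) hT κ κ' a b 0 u
  simpa only [Nat.cast_one, one_smul, zero_add] using h

/-- [folklore] **THE CELL COUNT OF THE ZERO-MODE CHARGE**: for a UNIT-COVARIANT bi-stencil family (e.g. leaf-02's transported family
`linT2 K N T` on the coarse lattice, by `LinT2ZeroMode.linT2_translate`) the period-`N` charge is `N^{d+1}` copies of the period-`1` charge: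
`zmode N X κ κ′ a b = N^{d+1} · zmode 1 X κ κ′ a b` — the density factor `Lc^{d+1}` of the W3 zero-mode eigenvalue. -/
theorem zmode_eq_pow_mul_zmode_one (N : ℕ) {X : Tab d}
    (h1 : ∀ κ u κ' u' t, X κ (u + t) κ' (u' + t) = shiftK (-t) (X κ u κ' u')) (κ κ' : Fin (d + 1)) (a b : Fib d) :
    zmode N X κ κ' a b = ((N : ℝ) ^ (d + 1)) * zmode 1 X κ κ' a b := by
  rw [zmode_one]
  unfold zmode
  rw [Finset.sum_congr rfl fun r _ => inner_const_of_unit_cov h1 κ κ' a b (toSite r), Finset.sum_const, card_box, nsmul_eq_mul]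
  push_cast
  ring

end Summit.QuantumFields.BalabanUV.Beta.GAN24.ZeroModeCoarseCount

end
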